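import Literature.Analysis.FluidPDE.AxisymNoSwirlScalarEq
import HarnessLib

/-!
# Pointwise algebra of the vorticity `ω = f · J` of a swirl-free axisymmetric field

Analysis/FluidPDE support file (all results proved, no definitions) on the decomposition path of
the named fact `Literature.Analysis.FluidPDE.axisymmetricNoSwirl_enstrophy_apriori`
(`AxisymmetricNoSwirlApriori.lean`; Lemarié-Rieusset 2016, Thm. 10.4: Ladyzhenskaya's a-priori
enstrophy bound for axisymmetric Navier–Stokes flows without swirl). For such a flow the
vorticity is `ω = ω_θ e_θ = f · J` with `Jx = (−x₁, x₀, 0) = r e_θ` (`Fluid.rotGen`) and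
`f = ω_θ / r` smooth across the axis (`AxisymNoSwirlVorticity.lean`,
`curl_eq_hadamardQuotFst_smul_rotGen`). This file expresses, pointwise and in Cartesian form,
the densities entering the weighted enstrophy identity (`TaoEnstrophyIdentity.lean`) through
`f` (`ρ = x₀² + x₁²`):

* `norm_sq_of_eq_smul_rotGen`: `|ω|² = f² ρ`;
* `inner_fderiv_apply_of_eq_smul_rotGen`: `⟨ω, Dω h⟩ = ρ f Df(h) + f² (x₀h₀ + x₁h₁)`;
* `frobeniusNormSq_fderiv_of_eq_smul_rotGen`: `|Dω|²_F = ρ|∇f|² + 2f(x₀∂₀f + x₁∂₁f) + 2f²`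
  (the book's `|∇⊗ω|² = |∂ᵣω_θ|² + |∂_zω_θ|² + ω_θ²/r²`, p. 286), and the Hardy-type
  consequence `sq_le_frobeniusNormSq_fderiv_of_eq_smul_rotGen`: `f² ≤ |Dω|²_F`
  (so `‖ω/r‖₂ ≤ ‖ω‖_{Ḣ¹}`);
* `inner_stretch_of_eq_smul_rotGen`: under the infinitesimal axisymmetry `DU(x)[Jx] = J U(x)`
  of the velocity (`IsAxisymmetric.fderiv_rotGen`), the stretching density is
  `⟨ω, (ω·∇)U⟩ = f²(x₀U₀ + x₁U₁) = u_r ω_θ²/r` (p. 289), whence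
  `|⟨ω, (ω·∇)U⟩| ≤ |f| |ω| |U|` (`abs_inner_stretch_le_of_eq_smul_rotGen`);
* `ladyzhenskaya_integrand_eq`: for a weight `η = w/ρ` the four densities of the weighted
  enstrophy identity combine to
  `−ν|∇f|²w − νf(∇f·∇w) − νf²(x₀∂₀w + x₁∂₁w)/ρ + ½f²(U·∇w)` — Ladyzhenskaya's cancellation
  (10.25) of transport against stretching, in pointwise form.

## References

* P. G. Lemarié-Rieusset, *The Navier–Stokes Problem in the 21st Century*, CRC Press (2016),
  §10.3, proof of Thm. 10.4, pp. 286–289 ((10.25) and the displays of pp. 287–288).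
  [LemarieRieusset2016]
-/

noncomputable section

open Set Function
open scoped RealInnerProductSpace

namespace Literature.Analysis.FluidPDE

/-! ### The infinitesimal rotation: norms and pairings with the standard basis -/

/-- `|J v|² = v₀² + v₁²`. [folklore] -/
theorem norm_rotGen_sq (v : EuclideanSpace ℝ (Fin 3)) :
    ‖rotGen v‖ ^ 2 = v 0 ^ 2 + v 1 ^ 2 := by
  rw [← real_inner_self_eq_norm_sq, inner_rotGen_self_eq]

/-- `|J v| = √(v₀² + v₁²)`. [folklore] -/
theorem norm_rotGen (v : EuclideanSpace ℝ (Fin 3)) :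
    ‖rotGen v‖ = Real.sqrt (v 0 ^ 2 + v 1 ^ 2) := by
  rw [← norm_rotGen_sq, Real.sqrt_sq (norm_nonneg _)]

/-- `|c J x|² = c² (x₀² + x₁²)`. [folklore] -/
theorem norm_smul_rotGen_sq (c : ℝ) (x : EuclideanSpace ℝ (Fin 3)) :
    ‖c • rotGen x‖ ^ 2 = c ^ 2 * (x 0 ^ 2 + x 1 ^ 2) := by
  rw [norm_smul, mul_pow, Real.norm_eq_abs, sq_abs, norm_rotGen_sq]

/-- `|c J x| = |c| √(x₀² + x₁²)`. [folklore] -/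
theorem norm_smul_rotGen (c : ℝ) (x : EuclideanSpace ℝ (Fin 3)) :
    ‖c • rotGen x‖ = |c| * Real.sqrt (x 0 ^ 2 + x 1 ^ 2) := by
  rw [norm_smul, Real.norm_eq_abs, norm_rotGen]

/-- `⟪J x, J e₀⟫ = x₀`. [folklore] -/
theorem inner_rotGen_rotGen_single_zero (x : EuclideanSpace ℝ (Fin 3)) :
    ⟪rotGen x, rotGen (EuclideanSpace.single (0 : Fin 3) (1 : ℝ))⟫ = x 0 := by
  rw [inner_rotGen_rotGen]; simp

/-- `⟪J x, J e₁⟫ = x₁`. [folklore] -/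
theorem inner_rotGen_rotGen_single_one (x : EuclideanSpace ℝ (Fin 3)) :
    ⟪rotGen x, rotGen (EuclideanSpace.single (1 : Fin 3) (1 : ℝ))⟫ = x 1 := by
  rw [inner_rotGen_rotGen]; simp

/-- `⟪J x, J e₂⟫ = 0`. [folklore] -/
theorem inner_rotGen_rotGen_single_two (x : EuclideanSpace ℝ (Fin 3)) :
    ⟪rotGen x, rotGen (EuclideanSpace.single (2 : Fin 3) (1 : ℝ))⟫ = 0 := by
  rw [inner_rotGen_rotGen]; simp

/-- `|J e₀|² = 1`, `|J e₁|² = 1`, `|J e₂|² = 0`. [folklore] -/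
theorem norm_rotGen_single_sq (j : Fin 3) :
    ‖rotGen (EuclideanSpace.single j (1 : ℝ))‖ ^ 2 = if j = 2 then 0 else 1 := by
  rw [norm_rotGen_sq]
  fin_cases j <;> simp

/-! ### Densities of `ω = f · J` -/

section SmulRotGen

variable {f : EuclideanSpace ℝ (Fin 3) → ℝ}
  {ω : EuclideanSpace ℝ (Fin 3) → EuclideanSpace ℝ (Fin 3)} {x : EuclideanSpace ℝ (Fin 3)}

/-- `D(fJ)(x) h = (Df(x) h) Jx + f(x) Jh` (restated for a field given as `ω = f · J`).
[folklore] -/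
theorem fderiv_apply_of_eq_smul_rotGen (hω : ω = fun y => f y • rotGen y)
    (hf : DifferentiableAt ℝ f x) (h : EuclideanSpace ℝ (Fin 3)) :
    fderiv ℝ ω x h = (fderiv ℝ f x h) • rotGen x + f x • rotGen h := by
  rw [hω]; exact fderiv_smul_rotGen_apply hf h

/-- `|ω(x)|² = f(x)² (x₀² + x₁²)` for `ω = f · J`. [folklore] -/
theorem norm_sq_of_eq_smul_rotGen (hω : ω = fun y => f y • rotGen y)
    (x : EuclideanSpace ℝ (Fin 3)) : ‖ω x‖ ^ 2 = f x ^ 2 * (x 0 ^ 2 + x 1 ^ 2) := by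
  rw [hω]; exact norm_smul_rotGen_sq (f x) x

/-- `⟪ω, Dω h⟫ = (x₀² + x₁²) f (Df h) + f² (x₀h₀ + x₁h₁)` for `ω = f · J`. [folklore] -/
theorem inner_fderiv_apply_of_eq_smul_rotGen (hω : ω = fun y => f y • rotGen y)
    (hf : DifferentiableAt ℝ f x) (h : EuclideanSpace ℝ (Fin 3)) :
    ⟪ω x, fderiv ℝ ω x h⟫ =
      (x 0 ^ 2 + x 1 ^ 2) * (f x * fderiv ℝ f x h) + f x ^ 2 * (x 0 * h 0 + x 1 * h 1) := by
  rw [fderiv_apply_of_eq_smul_rotGen hω hf h]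
  have hωx : ω x = f x • rotGen x := by rw [hω]
  rw [hωx, inner_add_right, real_inner_smul_left, real_inner_smul_right, real_inner_smul_left,
    real_inner_smul_right, inner_rotGen_self_eq, inner_rotGen_rotGen]
  ring

/-- **The gradient of `ω = f · J` in terms of `f`**:
`|Dω|²_F = (x₀² + x₁²) Σⱼ (∂ⱼf)² + 2 f (x₀∂₀f + x₁∂₁f) + 2 f²` (the Cartesian form of
`|∇ ⊗ ω|² = |∂ᵣω_θ|² + |∂_zω_θ|² + ω_θ²/r²`, `ω_θ = r f`; Lemarié-Rieusset 2016, p. 286).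
[cite: LemarieRieusset2016, §10.3 p. 286 (|∇⊗ω|² for ω = ω_θ e_θ)] -/
theorem frobeniusNormSq_fderiv_of_eq_smul_rotGen (hω : ω = fun y => f y • rotGen y)
    (hf : DifferentiableAt ℝ f x) :
    frobeniusNormSq (fderiv ℝ ω x) =
      (x 0 ^ 2 + x 1 ^ 2) * ∑ j, (fderiv ℝ f x (EuclideanSpace.single j (1 : ℝ))) ^ 2 +
        2 * f x * (x 0 * fderiv ℝ f x (EuclideanSpace.single 0 (1 : ℝ)) +
          x 1 * fderiv ℝ f x (EuclideanSpace.single 1 (1 : ℝ))) + 2 * f x ^ 2 := by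
  rw [frobeniusNormSq_eq_sum (EuclideanSpace.basisFun (Fin 3) ℝ)]
  simp only [EuclideanSpace.basisFun_apply]
  simp_rw [fderiv_apply_of_eq_smul_rotGen hω hf]
  rw [Fin.sum_univ_three, Fin.sum_univ_three]
  simp only [norm_add_sq_real, norm_smul_rotGen_sq, real_inner_smul_left, real_inner_smul_right,
    inner_rotGen_rotGen_single_zero, inner_rotGen_rotGen_single_one,
    inner_rotGen_rotGen_single_two]
  simp
  ring

/-- **Hardy-type pointwise bound `f² ≤ |Dω|²_F`** for `ω = f · J` (`(ω_θ/r)² ≤ |∇ ⊗ ω|²`,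
Lemarié-Rieusset 2016, p. 286): completing squares,
`ρ (|Dω|²_F − f²) = ρ² (∂₂f)² + (ρ∂₀f + f x₀)² + (ρ∂₁f + f x₁)² ≥ 0`, `ρ = x₀² + x₁²`.
[cite: LemarieRieusset2016, §10.3 p. 286] -/
theorem sq_le_frobeniusNormSq_fderiv_of_eq_smul_rotGen (hω : ω = fun y => f y • rotGen y)
    (hf : DifferentiableAt ℝ f x) : f x ^ 2 ≤ frobeniusNormSq (fderiv ℝ ω x) := by
  rw [frobeniusNormSq_fderiv_of_eq_smul_rotGen hω hf, Fin.sum_univ_three]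
  set p0 := fderiv ℝ f x (EuclideanSpace.single 0 (1 : ℝ))
  set p1 := fderiv ℝ f x (EuclideanSpace.single 1 (1 : ℝ))
  set p2 := fderiv ℝ f x (EuclideanSpace.single 2 (1 : ℝ))
  set a := x 0
  set b := x 1
  set c := f x
  by_cases hρ : a ^ 2 + b ^ 2 = 0
  · have ha : a = 0 := by nlinarith [sq_nonneg a, sq_nonneg b]
    have hb : b = 0 := by nlinarith [sq_nonneg a, sq_nonneg b]
    rw [ha, hb]
    nlinarith [sq_nonneg c]
  · have hρ' : 0 < a ^ 2 + b ^ 2 := lt_of_le_of_ne (by positivity) (Ne.symm hρ)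
    nlinarith [sq_nonneg ((a ^ 2 + b ^ 2) * p0 + c * a),
      sq_nonneg ((a ^ 2 + b ^ 2) * p1 + c * b), sq_nonneg ((a ^ 2 + b ^ 2) * p2),
      mul_pos hρ' hρ']

/-- **The vortex-stretching density of a swirl-free axisymmetric field**: if `ω(x) = f(x) Jx`
and the velocity gradient satisfies the infinitesimal axisymmetry `DU(x)[Jx] = J U(x)`, then
`⟪ω, (ω·∇)U⟫(x) = f² (x₀U₀ + x₁U₁) = ω_θ² u_r / r` (Lemarié-Rieusset 2016, p. 287 l. 2 and
p. 289: `∫ (ω·∇)u · ω = ∫ u_r ω_θ² / r`). [cite: LemarieRieusset2016, §10.3 pp. 287, 289] -/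
theorem inner_stretch_of_eq_smul_rotGen (hωx : ω x = f x • rotGen x)
    {U : EuclideanSpace ℝ (Fin 3) → EuclideanSpace ℝ (Fin 3)}
    (hax : fderiv ℝ U x (rotGen x) = rotGen (U x)) :
    ⟪ω x, fderiv ℝ U x (ω x)⟫ = f x ^ 2 * (x 0 * U x 0 + x 1 * U x 1) := by
  rw [hωx, map_smul, hax, real_inner_smul_left, real_inner_smul_right, inner_rotGen_rotGen]
  ring

/-- `|x₀u₀ + x₁u₁| ≤ √(x₀² + x₁²) |u|` (Cauchy–Schwarz in the horizontal plane). [folklore] -/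
theorem abs_horizontal_inner_le (x u : EuclideanSpace ℝ (Fin 3)) :
    |x 0 * u 0 + x 1 * u 1| ≤ Real.sqrt (x 0 ^ 2 + x 1 ^ 2) * ‖u‖ := by
  have hu : ‖u‖ ^ 2 = u 0 ^ 2 + u 1 ^ 2 + u 2 ^ 2 := by
    rw [EuclideanSpace.norm_sq_eq, Fin.sum_univ_three]
    simp only [Real.norm_eq_abs, sq_abs]
  have h1 : (x 0 * u 0 + x 1 * u 1) ^ 2 ≤ (x 0 ^ 2 + x 1 ^ 2) * ‖u‖ ^ 2 := by
    rw [hu]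
    nlinarith [sq_nonneg (x 0 * u 1 - x 1 * u 0), sq_nonneg (u 2), sq_nonneg (x 0),
      sq_nonneg (x 1),
      mul_nonneg (add_nonneg (sq_nonneg (x 0)) (sq_nonneg (x 1))) (sq_nonneg (u 2))]
  calc |x 0 * u 0 + x 1 * u 1| ≤ Real.sqrt ((x 0 ^ 2 + x 1 ^ 2) * ‖u‖ ^ 2) := Real.abs_le_sqrt h1
    _ = Real.sqrt (x 0 ^ 2 + x 1 ^ 2) * ‖u‖ := by
        rw [Real.sqrt_mul (by positivity), Real.sqrt_sq (norm_nonneg _)]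

/-- **Pointwise bound for the stretching density**: `|⟪ω, (ω·∇)U⟫| ≤ |f| |ω| |U|` for a
swirl-free axisymmetric field (`|u_r ω_θ²/r| ≤ |u| |ω_θ/r| |ω_θ|`, the pointwise form of
`∫ u_r ω_θ² /r ≤ ‖u_r‖_∞ ‖ω‖₂ ‖ω/r‖₂`, Lemarié-Rieusset 2016, p. 289).
[cite: LemarieRieusset2016, §10.3 p. 289] -/
theorem abs_inner_stretch_le_of_eq_smul_rotGen (hωx : ω x = f x • rotGen x)
    {U : EuclideanSpace ℝ (Fin 3) → EuclideanSpace ℝ (Fin 3)}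
    (hax : fderiv ℝ U x (rotGen x) = rotGen (U x)) :
    |⟪ω x, fderiv ℝ U x (ω x)⟫| ≤ |f x| * ‖ω x‖ * ‖U x‖ := by
  rw [inner_stretch_of_eq_smul_rotGen hωx hax, abs_mul, abs_pow, sq_abs, hωx, norm_smul_rotGen]
  have h := abs_horizontal_inner_le x (U x)
  have hf2 : f x ^ 2 = |f x| * |f x| := by rw [← sq, sq_abs]
  rw [hf2]
  calc |f x| * |f x| * |x 0 * U x 0 + x 1 * U x 1|
      ≤ |f x| * |f x| * (Real.sqrt (x 0 ^ 2 + x 1 ^ 2) * ‖U x‖) :=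
        mul_le_mul_of_nonneg_left h (by positivity)
    _ = |f x| * (|f x| * Real.sqrt (x 0 ^ 2 + x 1 ^ 2)) * ‖U x‖ := by ring

end SmulRotGen

/-! ### Weights of the form `w / ρ`, `ρ = x₀² + x₁²` -/

section OverRho

/-- The squared distance to the axis `ρ(x) = x₀² + x₁²` has derivative
`Dρ(x) = 2x₀ dx₀ + 2x₁ dx₁`. [folklore] -/
theorem hasFDerivAt_horizSq (x : EuclideanSpace ℝ (Fin 3)) :
    HasFDerivAt (fun y : EuclideanSpace ℝ (Fin 3) => y 0 ^ 2 + y 1 ^ 2)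
      ((2 * x 0) • (EuclideanSpace.proj (0 : Fin 3) : EuclideanSpace ℝ (Fin 3) →L[ℝ] ℝ) +
        (2 * x 1) • (EuclideanSpace.proj (1 : Fin 3) : EuclideanSpace ℝ (Fin 3) →L[ℝ] ℝ)) x := by
  have h0 : HasFDerivAt (fun y : EuclideanSpace ℝ (Fin 3) => y 0)
      (EuclideanSpace.proj (0 : Fin 3) : EuclideanSpace ℝ (Fin 3) →L[ℝ] ℝ) x :=
    (EuclideanSpace.proj (0 : Fin 3) : EuclideanSpace ℝ (Fin 3) →L[ℝ] ℝ).hasFDerivAt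
  have h1 : HasFDerivAt (fun y : EuclideanSpace ℝ (Fin 3) => y 1)
      (EuclideanSpace.proj (1 : Fin 3) : EuclideanSpace ℝ (Fin 3) →L[ℝ] ℝ) x :=
    (EuclideanSpace.proj (1 : Fin 3) : EuclideanSpace ℝ (Fin 3) →L[ℝ] ℝ).hasFDerivAt
  have h0' : HasFDerivAt (fun y : EuclideanSpace ℝ (Fin 3) => y 0 ^ 2)
      ((2 * x 0) • (EuclideanSpace.proj (0 : Fin 3) : EuclideanSpace ℝ (Fin 3) →L[ℝ] ℝ)) x := by
    have h2 : (fun y : EuclideanSpace ℝ (Fin 3) => y 0 ^ 2) = fun y => y 0 * y 0 :=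
      funext fun y => sq (y 0)
    rw [h2]
    refine (h0.fun_mul h0).congr_fderiv ?_
    rw [two_mul, add_smul]
  have h1' : HasFDerivAt (fun y : EuclideanSpace ℝ (Fin 3) => y 1 ^ 2)
      ((2 * x 1) • (EuclideanSpace.proj (1 : Fin 3) : EuclideanSpace ℝ (Fin 3) →L[ℝ] ℝ)) x := by
    have h2 : (fun y : EuclideanSpace ℝ (Fin 3) => y 1 ^ 2) = fun y => y 1 * y 1 :=
      funext fun y => sq (y 1)
    rw [h2]
    refine (h1.fun_mul h1).congr_fderiv ?_
    rw [two_mul, add_smul]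
  exact h0'.fun_add h1'

/-- `ρ` is smooth. [folklore] -/
theorem contDiff_horizSq {n : WithTop ℕ∞} :
    ContDiff ℝ n (fun y : EuclideanSpace ℝ (Fin 3) => y 0 ^ 2 + y 1 ^ 2) :=
  ((contDiff_piLp_apply (𝕜 := ℝ) (p := 2) (i := (0 : Fin 3))).pow 2).add
    ((contDiff_piLp_apply (𝕜 := ℝ) (p := 2) (i := (1 : Fin 3))).pow 2)

/-- `Dρ(x) h = 2 (x₀h₀ + x₁h₁)`. [folklore] -/
theorem fderiv_horizSq_apply (x h : EuclideanSpace ℝ (Fin 3)) :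
    fderiv ℝ (fun y : EuclideanSpace ℝ (Fin 3) => y 0 ^ 2 + y 1 ^ 2) x h =
      2 * (x 0 * h 0 + x 1 * h 1) := by
  rw [(hasFDerivAt_horizSq x).fderiv]
  simp [EuclideanSpace.proj]
  ring

/-- **Derivative of a weight divided by `ρ`** off the axis:
`D(w/ρ)(x) h = Dw(x)h / ρ − 2 w(x) (x₀h₀ + x₁h₁) / ρ²`. [folklore] -/
theorem fderiv_div_horizSq_apply {w : EuclideanSpace ℝ (Fin 3) → ℝ} {x : EuclideanSpace ℝ (Fin 3)}
    (hw : DifferentiableAt ℝ w x) (hρ : x 0 ^ 2 + x 1 ^ 2 ≠ 0) (h : EuclideanSpace ℝ (Fin 3)) :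
    fderiv ℝ (fun y => w y / (y 0 ^ 2 + y 1 ^ 2)) x h =
      fderiv ℝ w x h / (x 0 ^ 2 + x 1 ^ 2) -
        w x * (2 * (x 0 * h 0 + x 1 * h 1)) / (x 0 ^ 2 + x 1 ^ 2) ^ 2 := by
  have hinv : HasFDerivAt (fun y : EuclideanSpace ℝ (Fin 3) => (y 0 ^ 2 + y 1 ^ 2)⁻¹)
      ((-((x 0 ^ 2 + x 1 ^ 2) ^ 2)⁻¹) •
        ((2 * x 0) • (EuclideanSpace.proj (0 : Fin 3) : EuclideanSpace ℝ (Fin 3) →L[ℝ] ℝ) +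
          (2 * x 1) • (EuclideanSpace.proj (1 : Fin 3) : EuclideanSpace ℝ (Fin 3) →L[ℝ] ℝ))) x :=
    (hasDerivAt_inv hρ).comp_hasFDerivAt x (hasFDerivAt_horizSq x)
  have hmul := hw.hasFDerivAt.fun_mul hinv
  have heq : (fun y => w y / (y 0 ^ 2 + y 1 ^ 2)) =
      fun y : EuclideanSpace ℝ (Fin 3) => w y * (y 0 ^ 2 + y 1 ^ 2)⁻¹ :=
    funext fun y => div_eq_mul_inv _ _
  rw [heq, hmul.fderiv]
  simp [EuclideanSpace.proj]
  field_simp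
  ring

variable {f : EuclideanSpace ℝ (Fin 3) → ℝ}
  {ω : EuclideanSpace ℝ (Fin 3) → EuclideanSpace ℝ (Fin 3)} {x : EuclideanSpace ℝ (Fin 3)}

/-- **Ladyzhenskaya's weighted enstrophy integrand for a swirl-free axisymmetric field.** Let
`ω = f · J` (`f` differentiable at `x`), let the velocity gradient satisfy `DU(x)[Jx] = J U(x)`,
and let `η = w / ρ` with `w` differentiable at `x`, `ρ = x₀² + x₁² ≠ 0`. Then the four densities
of the weighted enstrophy identity (viscous `−ν|Dω|²η − ν Σⱼ⟨ω,∂ⱼω⟩∂ⱼη`, transport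
`½|ω|² (U·∇η)`, stretching `⟨ω,(ω·∇)U⟩ η`) combine to
`−ν |∇f|² w − ν f (∇f·∇w) − ν f² (x₀∂₀w + x₁∂₁w)/ρ + ½ f² (U·∇w)`:
transport and stretching cancel up to `½ f² (U·∇w)` — Ladyzhenskaya's identity
`∫ ((ω·∇)u − (u·∇)ω)·ω dx/r² = 0` in pointwise form (Lemarié-Rieusset 2016, (10.25) and the
computation of p. 287 l. 1–3 with the weight `α_ε(r)/r²`) — and the viscous terms give the
dissipation of `f = ω_θ/r` plus weight-derivative terms (p. 288, first display).
[cite: LemarieRieusset2016, §10.3 (10.25) and pp. 287–288] -/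
theorem ladyzhenskaya_integrand_eq (hω : ω = fun y => f y • rotGen y)
    (hf : DifferentiableAt ℝ f x) {w : EuclideanSpace ℝ (Fin 3) → ℝ}
    (hw : DifferentiableAt ℝ w x) (hρ : x 0 ^ 2 + x 1 ^ 2 ≠ 0)
    {U : EuclideanSpace ℝ (Fin 3) → EuclideanSpace ℝ (Fin 3)}
    (hax : fderiv ℝ U x (rotGen x) = rotGen (U x)) (ν : ℝ) :
    -(ν * (frobeniusNormSq (fderiv ℝ ω x) * (w x / (x 0 ^ 2 + x 1 ^ 2))))
      - ν * (∑ j, ⟪ω x, fderiv ℝ ω x (EuclideanSpace.single j (1 : ℝ))⟫ *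
          fderiv ℝ (fun y => w y / (y 0 ^ 2 + y 1 ^ 2)) x (EuclideanSpace.single j (1 : ℝ)))
      + 1 / 2 * (‖ω x‖ ^ 2 * fderiv ℝ (fun y => w y / (y 0 ^ 2 + y 1 ^ 2)) x (U x))
      + ⟪ω x, fderiv ℝ U x (ω x)⟫ * (w x / (x 0 ^ 2 + x 1 ^ 2)) =
    -(ν * ((∑ j, (fderiv ℝ f x (EuclideanSpace.single j (1 : ℝ))) ^ 2) * w x))
      - ν * (f x * ∑ j, fderiv ℝ f x (EuclideanSpace.single j (1 : ℝ)) *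
          fderiv ℝ w x (EuclideanSpace.single j (1 : ℝ)))
      - ν * (f x ^ 2 * (x 0 * fderiv ℝ w x (EuclideanSpace.single 0 (1 : ℝ)) +
          x 1 * fderiv ℝ w x (EuclideanSpace.single 1 (1 : ℝ))) / (x 0 ^ 2 + x 1 ^ 2))
      + 1 / 2 * (f x ^ 2 * fderiv ℝ w x (U x)) := by
  have hωx : ω x = f x • rotGen x := by rw [hω]
  rw [frobeniusNormSq_fderiv_of_eq_smul_rotGen hω hf, inner_stretch_of_eq_smul_rotGen hωx hax,
    norm_sq_of_eq_smul_rotGen hω x]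
  simp_rw [inner_fderiv_apply_of_eq_smul_rotGen hω hf, fderiv_div_horizSq_apply hw hρ]
  simp only [Fin.sum_univ_three, PiLp.single_apply]
  simp
  field_simp
  ring

end OverRho

end Literature.Analysis.FluidPDE

end
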